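import Mathlib.Topology.ContinuousMap.SecondCountableSpace
import Mathlib.LinearAlgebra.Multilinear.FiniteDimensional
import Mathlib.Analysis.Normed.Module.FiniteDimension
import Literature.Analysis.FunctionSpaces.NuclearSpace
import HarnessLib

/-!
# Discharged fact: the Schwartz space is separable (`NuclearSpace`)

`Literature.Analysis.FunctionSpaces.NuclearSpace` records, as the named fact
`Literature.separableSpace_schwartzMap E F`, that for finite-dimensional real normed spaces `E`, `F` the
Schwartz space `𝓢(E, F)` (Mathlib `SchwartzMap`, with its Fréchet topology
`schwartz_withSeminorms`) is a separable topological space (Trèves, *Topological vector spaces,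
distributions and kernels* (1967), Appendix p. 556: `𝒮(𝐑ⁿ)` is a separable Fréchet space, listed
there with Prop. A.9 among the Souslin spaces; Gel'fand–Vilenkin IV, Ch. I §3.6 via the Hermite
expansion). This file proves it:

* `Literature.separableSpace_schwartzMap_holds : separableSpace_schwartzMap E F`,

so that users holding `(h : separableSpace_schwartzMap E F)` (the Minlos item, and the uniqueness
theorem `Literature.MathematicalPhysics.QuantumLattice.ext_of_genFunctional`) can discharge the hypothesis.

## Proof

We do not use Hermite expansions (absent from Mathlib). Instead (a soft argument giving the same
statement):

1. `Literature.Analysis.FunctionSpaces.SchwartzMap.exists_countable_dense_seminorm`: the map `f ↦ (D^n f)_{n ∈ ℕ}` sends `𝓢(E, F)`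
   into the countable product `Π n, C(E, E [×n]→L[ℝ] F)` of spaces of continuous maps with the
   compact-open topology, which is second countable (Mathlib
   `ContinuousMap.instSecondCountableTopology`: `E` is second countable and locally compact,
   `E [×n]→L[ℝ] F` is finite dimensional). Hence every seminorm-bounded set
   `B(N, C) = {g : p_{k,n}(g) ≤ C, k, n ≤ N}` contains a countable subset `D(N, C)` whose
   derivatives approximate those of any `g ∈ B(N, C)` uniformly on compact sets. On `B(N, C)` this
   controls the Schwartz seminorms of order `< N`: for `k, n ≤ M < N` and `R ≥ 1`,
   `‖x‖^k ‖D^n g(x)‖ ≤ max (R^M sup_{‖x‖ ≤ R} ‖D^n g‖, p_{k+1,n}(g) / R)`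
   (`Literature.Analysis.FunctionSpaces.SchwartzMap.seminorm_le_max_of_ball_of_succ`), and `p_{k+1,n} ≤ 2C` on differences of
   elements of `B(N, C)`. The countable set `⋃_{N,C} D(N, C)` is therefore dense for every finite
   family of Schwartz seminorms.
2. `Literature.Analysis.FunctionSpaces.separableSpace_schwartzMap_holds`: the Schwartz topology has the seminorm balls
   `{g : (s.sup p)(g - f) < r}` as a neighbourhood basis (`WithSeminorms.hasBasis_ball`), so the set
   of step 1 is dense.

## References

* F. Trèves, *Topological vector spaces, distributions and kernels*, Academic Press (1967),
  Thm 14.5 (closed bounded subsets of `𝒮` are compact), Appendix p. 556 with Prop. A.9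
  (`𝒮(𝐑ⁿ)` is a separable Fréchet space; its weak dual is a Souslin space), Cor. of Thm 51.5
  (`𝒮` is nuclear). [Treves1967]
* I. M. Gel'fand, N. Ya. Vilenkin, *Generalized Functions IV* (1964), Ch. I §3.6.
  [GelfandVilenkinIV1964]
-/

open scoped SchwartzMap Topology
open Set Filter TopologicalSpace

namespace Literature.Analysis.FunctionSpaces

namespace SchwartzMap

variable {E F : Type*} [NormedAddCommGroup E] [NormedSpace ℝ E] [NormedAddCommGroup F]
  [NormedSpace ℝ F]

/-- Tail estimate for Schwartz seminorms: if `‖x‖^k ‖D^n g(x)‖ ≤ A` on the ball `‖x‖ ≤ R`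
(`R > 0`) and `p_{k+1,n}(g) ≤ B`, then `p_{k,n}(g) ≤ max A (B / R)` — outside the ball,
`‖x‖^k ‖D^n g(x)‖ = ‖x‖^{k+1} ‖D^n g(x)‖ / ‖x‖ ≤ B / R`. This is the elementary step showing that
on bounded sets of `𝒮` the topology is that of uniform convergence of derivatives on compacta
(the mechanism behind Trèves 1967, Thm 14.5: closed bounded subsets of `𝒮` are compact).
[folklore] -/
theorem seminorm_le_max_of_ball_of_succ (g : 𝓢(E, F)) (k n : ℕ) {R A B : ℝ} (hR : 0 < R)
    (hA : ∀ x : E, ‖x‖ ≤ R → ‖x‖ ^ k * ‖iteratedFDeriv ℝ n g x‖ ≤ A)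
    (hB : SchwartzMap.seminorm ℝ (k + 1) n g ≤ B) :
    SchwartzMap.seminorm ℝ k n g ≤ max A (B / R) := by
  have hA0 : 0 ≤ A := le_trans (by positivity) (hA 0 (by simpa using hR.le))
  refine SchwartzMap.seminorm_le_bound ℝ k n g (le_max_of_le_left hA0) fun x => ?_
  rcases le_or_gt ‖x‖ R with hx | hx
  · exact (hA x hx).trans (le_max_left _ _)
  · have hx0 : 0 < ‖x‖ := hR.trans hx
    have hB0 : 0 ≤ B := le_trans (apply_nonneg _ _) hB
    calc ‖x‖ ^ k * ‖iteratedFDeriv ℝ n g x‖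
        = (‖x‖ ^ (k + 1) * ‖iteratedFDeriv ℝ n g x‖) / ‖x‖ := by
          rw [eq_div_iff hx0.ne']
          ring
      _ ≤ B / ‖x‖ := by
          gcongr
          exact (SchwartzMap.le_seminorm ℝ (k + 1) n g x).trans hB
      _ ≤ B / R := div_le_div_of_nonneg_left hB0 hR hx.le
      _ ≤ max A (B / R) := le_max_right _ _

/-- **A countable set dense for every finite family of Schwartz seminorms.** For
finite-dimensional `E`, `F` there is a countable `D ⊆ 𝓢(E, F)` such that every `f` can be
approximated by some `d ∈ D` simultaneously in all seminorms `p_{k,n}`, `k, n ≤ M`, to any accuracy.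
Proof: embed `𝒮` into the second-countable space `Π n, C(E, E [×n]→L[ℝ] F)` (compact-open
topologies) by `f ↦ (D^n f)_n`, take countable subsets of the seminorm-bounded sets `B(N, C)` that
are dense there, and use `seminorm_le_max_of_ball_of_succ`. Equivalent to the separability of `𝒮`
(Trèves 1967, Appendix p. 556). [cite: Treves1967, Appendix p. 556 (with Prop. A.9)] -/
theorem exists_countable_dense_seminorm [FiniteDimensional ℝ E] [FiniteDimensional ℝ F] :
    ∃ D : Set 𝓢(E, F), D.Countable ∧ ∀ (f : 𝓢(E, F)) (M : ℕ) (ε : ℝ), 0 < ε →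
      ∃ d ∈ D, ∀ k n : ℕ, k ≤ M → n ≤ M → SchwartzMap.seminorm ℝ k n (f - d) < ε := by
  -- Step 0: the receiving space `Y = Π n, C(E, E [×n]→L[ℝ] F)` is second countable.
  haveI hV : ∀ n : ℕ, FiniteDimensional ℝ (E [×n]→L[ℝ] F) := fun n =>
    FiniteDimensional.of_injective
      (ContinuousMultilinearMap.toMultilinearMapLinear (R' := ℝ) (A := ℝ)
        (M₁ := fun _ : Fin n => E) (M₂ := F))
      ContinuousMultilinearMap.toMultilinearMap_injective
  let Y : Type _ := (n : ℕ) → C(E, E [×n]→L[ℝ] F)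
  let Ψ : 𝓢(E, F) → Y := fun f n =>
    ⟨iteratedFDeriv ℝ n (⇑f), (f.smooth n).continuous_iteratedFDeriv'⟩
  -- the seminorm-bounded sets
  let B : ℕ × ℕ → Set 𝓢(E, F) := fun p =>
    {g | ∀ k n : ℕ, k ≤ p.1 → n ≤ p.1 → SchwartzMap.seminorm ℝ k n g ≤ (p.2 : ℝ)}
  -- Step 1: countable `D p ⊆ B p` with `Ψ '' B p ⊆ closure (Ψ '' D p)`.
  have key : ∀ p, ∃ D ⊆ B p, D.Countable ∧ Ψ '' B p ⊆ closure (Ψ '' D) := by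
    intro p
    obtain ⟨c, c_count, c_dense⟩ := TopologicalSpace.exists_countable_dense (Ψ '' B p)
    have hc : ∀ y : c, ∃ g ∈ B p, Ψ g = ((y : Ψ '' B p) : Y) := fun y => (y : Ψ '' B p).2
    choose σ hσB hσ using hc
    haveI : Countable c := c_count.to_subtype
    refine ⟨range σ, range_subset_iff.2 hσB, countable_range σ, ?_⟩
    have h1 : Ψ '' B p ⊆ closure (((↑) : Ψ '' B p → Y) '' c) := Subtype.dense_iff.1 c_dense
    refine h1.trans (closure_mono ?_)
    rintro _ ⟨y, hy, rfl⟩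
    exact ⟨σ ⟨y, hy⟩, mem_range_self _, hσ ⟨y, hy⟩⟩
  choose D hDB hDc hDd using key
  refine ⟨⋃ p, D p, countable_iUnion hDc, fun f M ε hε => ?_⟩
  -- Step 2: `f ∈ B (M + 1, C)` for a natural number `C`.
  obtain ⟨C, hC⟩ : ∃ C : ℕ, ∀ k n : ℕ, k ≤ M + 1 → n ≤ M + 1 →
      SchwartzMap.seminorm ℝ k n f ≤ (C : ℝ) := by
    refine ⟨⌈((Finset.Iic (M + 1, M + 1)).sup (schwartzSeminormFamily ℝ E F)) f⌉₊,
      fun k n hk hn => le_trans ?_ (Nat.le_ceil _)⟩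
    exact Seminorm.le_def.1 (Finset.le_sup (f := schwartzSeminormFamily ℝ E F)
      (Finset.mem_Iic.2 (Prod.mk_le_mk.2 ⟨hk, hn⟩))) f
  have hfB : f ∈ B (M + 1, C) := fun k n hk hn => hC k n hk hn
  -- Step 3: constants.
  set R : ℝ := max 1 (4 * C / ε) with hRdef
  have hR1 : 1 ≤ R := le_max_left _ _
  have hR0 : 0 < R := one_pos.trans_le hR1
  set δ : ℝ := ε / (4 * R ^ M) with hδdef
  have hδ : 0 < δ := by positivity
  -- Step 4: a neighbourhood of `Ψ f`: derivatives of order `≤ M` are `δ`-close on the `R`-ball.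
  set W : Set Y := ⋂ n ∈ Finset.range (M + 1),
      (fun y : Y => y n) ⁻¹' {g | ∀ x ∈ Metric.closedBall (0 : E) R, dist (Ψ f n x) (g x) < δ}
    with hWdef
  have hW : W ∈ 𝓝 (Ψ f) := by
    refine (Filter.biInter_finset_mem _).2 fun n _ => ?_
    refine (continuous_apply n).continuousAt.preimage_mem_nhds ?_
    exact UniformSpace.ball_mem_nhds (Ψ f n)
      (ContinuousMap.hasBasis_compactConvergenceUniformity.mem_of_mem
        (i := (Metric.closedBall (0 : E) R,
          {q : (E [×n]→L[ℝ] F) × (E [×n]→L[ℝ] F) | dist q.1 q.2 < δ}))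
        ⟨isCompact_closedBall (0 : E) R, Metric.dist_mem_uniformity hδ⟩)
  -- Step 5: pick `d ∈ D (M + 1, C)` with `Ψ d ∈ W`.
  obtain ⟨y, hyW, ⟨d, hd, rfl⟩⟩ :=
    mem_closure_iff_nhds.1 (hDd (M + 1, C) (mem_image_of_mem Ψ hfB)) W hW
  have hdB : d ∈ B (M + 1, C) := hDB _ hd
  refine ⟨d, mem_iUnion.2 ⟨(M + 1, C), hd⟩, fun k n hk hn => ?_⟩
  -- Step 6: the estimates.
  have hclose : ∀ x ∈ Metric.closedBall (0 : E) R, dist (Ψ f n x) (Ψ d n x) < δ :=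
    (mem_iInter₂.1 hyW) n (Finset.mem_range.2 (Nat.lt_succ_of_le hn))
  have hnear : ∀ x : E, ‖x‖ ≤ R →
      ‖x‖ ^ k * ‖iteratedFDeriv ℝ n (⇑(f - d)) x‖ ≤ R ^ M * δ := by
    intro x hx
    have h1 : ‖x‖ ^ k ≤ R ^ M :=
      (pow_le_pow_left₀ (norm_nonneg _) hx k).trans (pow_le_pow_right₀ hR1 hk)
    have h2 : ‖iteratedFDeriv ℝ n (⇑(f - d)) x‖ ≤ δ := by
      have h3 := iteratedFDeriv_sub_apply (𝕜 := ℝ) (i := n) (x := x)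
        (f.smooth n).contDiffAt (d.smooth n).contDiffAt
      have h4 : (⇑(f - d) : E → F) = ⇑f - ⇑d := rfl
      rw [h4, h3, ← dist_eq_norm]
      exact (hclose x (mem_closedBall_zero_iff.2 hx)).le
    exact mul_le_mul h1 h2 (norm_nonneg _) (by positivity)
  have hfar : SchwartzMap.seminorm ℝ (k + 1) n (f - d) ≤ 2 * C := by
    calc SchwartzMap.seminorm ℝ (k + 1) n (f - d)
        ≤ SchwartzMap.seminorm ℝ (k + 1) n f + SchwartzMap.seminorm ℝ (k + 1) n d :=
          map_sub_le_add _ f d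
      _ ≤ C + C := add_le_add (hC _ _ (by omega) (by omega)) (hdB _ _ (by omega) (by omega))
      _ = 2 * C := by ring
  have hmain := seminorm_le_max_of_ball_of_succ (f - d) k n hR0 hnear hfar
  refine hmain.trans_lt (max_lt ?_ ?_)
  · have : R ^ M * δ = ε / 4 := by
      rw [hδdef]
      field_simp
    rw [this]
    linarith
  · have hle : 4 * C / ε ≤ R := le_max_right _ _
    have hC0 : (0 : ℝ) ≤ C := Nat.cast_nonneg _
    rw [div_lt_iff₀ hR0]
    have hεR := mul_pos hε hR0
    calc (2 : ℝ) * C = (4 * C / ε) * (ε / 2) := by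
          field_simp
          ring
      _ ≤ R * (ε / 2) := by gcongr
      _ < ε * R := by nlinarith

end SchwartzMap

/-- Discharge of `separableSpace_schwartzMap`: **the Schwartz space `𝓢(E, F)` is separable** for
finite-dimensional `E`, `F` (Trèves 1967, Appendix p. 556: `𝒮(𝐑ⁿ)` is a separable Fréchet space,
listed there with Prop. A.9 among the Souslin spaces; it is Montel by Thm 14.5; Gel'fand–Vilenkin
IV, Ch. I §3.6). Proof: the countable set of
`SchwartzMap.exists_countable_dense_seminorm` meets every seminorm ball `(s.sup p).ball f r`, and
these balls form a neighbourhood basis of the Schwartz topology (`WithSeminorms.hasBasis_ball`).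
[cite: Treves1967, Appendix p. 556 (with Prop. A.9)] -/
theorem separableSpace_schwartzMap_holds (E F : Type*) [NormedAddCommGroup E] [NormedSpace ℝ E]
    [NormedAddCommGroup F] [NormedSpace ℝ F] : separableSpace_schwartzMap E F := by
  intro _ _
  obtain ⟨D, hDc, hD⟩ := SchwartzMap.exists_countable_dense_seminorm (E := E) (F := F)
  refine ⟨D, hDc, fun f => ?_⟩
  rw [mem_closure_iff_nhds_basis (schwartz_withSeminorms ℝ E F).hasBasis_ball]
  rintro ⟨s, r⟩ hr
  obtain ⟨d, hdD, hd⟩ := hD f (s.sup fun i => max i.1 i.2) r hr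
  refine ⟨d, hdD, ?_⟩
  change d ∈ (s.sup (schwartzSeminormFamily ℝ E F)).ball f r
  rw [Seminorm.mem_ball, map_sub_rev]
  refine Seminorm.finset_sup_apply_lt hr fun i hi => ?_
  have h1 : i.1 ≤ s.sup fun i => max i.1 i.2 :=
    (le_max_left i.1 i.2).trans (Finset.le_sup (f := fun i : ℕ × ℕ => max i.1 i.2) hi)
  have h2 : i.2 ≤ s.sup fun i => max i.1 i.2 :=
    (le_max_right i.1 i.2).trans (Finset.le_sup (f := fun i : ℕ × ℕ => max i.1 i.2) hi)
  exact hd i.1 i.2 h1 h2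

end Literature.Analysis.FunctionSpaces
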